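import Mathlib
import HarnessLib
import Literature.MathematicalPhysics.QuantumFieldTheory.StrongCouplingTorusLimit

/-!
# `CurvatureKernelBound` — brick `TorusFiniteSizeRate`, support I: cross-stabilisation of ratio
# jets with an explicit torus threshold (single removal)
# (crux stmt-QuantumFields-11687, line `coupling-trichotomy`)

`Literature.MathematicalPhysics.QuantumFieldTheory.StrongCouplingTorusLimit` proves the
*cross-stabilisation of jets* `cstab`: for every order `n` the Taylor jets at `β = 0` of the torus
ratios of partition functions `R^T_{L+1}(H, E)` agree with the stabilised free jets *for all large
`L`* (`∀ᶠ L in atTop`). This support file makes the threshold **explicit and linear in the order**: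
the torus clause of order `m` holds for every torus of side `L + 1` with `2 (r + m + 2) ≤ L` as soon
as the base points of `H ∪ E` lie within sup-distance `r` of some lattice point. Here: the explicit
injectivity windows of the covering projection (`injOn_torusEdge_of_natAbs_le`,
`injOn_torusProj_of_natAbs_le`: the projection is injective on every window of sup-diameter
`< L`), order `0` (`cstabE_zero`) and the single-removal inductive step `cstabE_single` (the tree
proof of `cstab_single` with `eventually_injOn_torusProj`/`eventually_injOn_torusEdge` replaced by
the explicit windows; the induction hypotheses for `(insert q H, nbAll X)`, `X` connected through
`q` of size `s ≤ n + 1`, are used with radius `r + s`), packaged as the registered sub-goal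
**`TorusCrossStabSingle`**. The telescoping, the strong induction and the expectations are in the
sequel files `…TorusFiniteSizeRateExpect`, `…TorusFiniteSizeRate`.

## References

* K. Osterwalder, E. Seiler, *Gauge field theories on a lattice*, Ann. Phys. 110 (1978) 440–471,
  §3, Thms. 3.6–3.7 [OsterwalderSeilerAnnPhys1978].
* E. Seiler, *Gauge Theories as a Problem of Constructive Quantum Field Theory and Statistical
  Mechanics*, LNP 159 (1982), Ch. 2–3 [SeilerLNP1982].
-/

noncomputable section

open scoped BigOperators Topology
open MeasureTheory Filter
open Literature.MathematicalPhysics Literature.MathematicalPhysics.QuantumFieldTheory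
open Literature.Probability.LatticeModels

namespace Summit.QuantumFields.YangMills.Theorems.CurvatureKernel

variable {d N : ℕ} {G : Type*}

/-! ### Explicit injectivity windows of the covering projection -/

/-- `torusEdge L` is injective on bonds whose base points lie within sup-distance `r` of a point,
as soon as `2 r < L`. [folklore] -/
theorem injOn_torusEdge_of_natAbs_le {c : Literature.Probability.LatticeModels.Site d} {r L : ℕ}
    (hL : 2 * r < L) {S : Set (ZdEdge d)} (hS : ∀ e ∈ S, ∀ k, (e.1 k - c k).natAbs ≤ r) :
    Set.InjOn (QuantumLattice.torusEdge (d := d) L) S := by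
  intro e he e' he' h
  simp only [QuantumLattice.torusEdge, Prod.mk.injEq] at h
  refine Prod.ext (eq_of_torusProj_eq_of_natAbs_lt h.1 fun k => ?_) h.2
  have h1 := hS e he k
  have h2 := hS e' he' k
  omega

/-- `torusProj L` is injective on plaquette labels whose base points lie within sup-distance `r`
of a point, as soon as `2 r < L`. [folklore] -/
theorem injOn_torusProj_of_natAbs_le {c : Literature.Probability.LatticeModels.Site d} {r L : ℕ}
    (hL : 2 * r < L) {Q : Set (Plaq d)} (hQ : ∀ p ∈ Q, ∀ k, (p.1 k - c k).natAbs ≤ r) :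
    Set.InjOn (torusProj (d := d) L) Q := by
  intro p hp p' hp' h
  have h1 : (Torus.proj L p.1 : Literature.MathematicalPhysics.QuantumFieldTheory.Site d L) =
      Torus.proj L p'.1 := by
    simpa using congr_arg Prod.fst h
  have h2 : p.2 = p'.2 := by simpa using congr_arg Prod.snd h
  refine Prod.ext (eq_of_torusProj_eq_of_natAbs_lt h1 fun k => ?_) h2
  have h3 := hQ p hp k
  have h4 := hQ p' hp' k
  omega

/-! ### Cross-stabilisation of the jets of ratios with an explicit threshold -/

section CrossStab

variable [Group G] [TopologicalSpace G] [IsTopologicalGroup G] [CompactSpace G] [MeasurableSpace G]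
  [BorelSpace G] {ρ : G →* Matrix (Fin N) (Fin N) ℂ}

/-- Order `0` of the explicit cross-stabilisation: boundedness on both sides. [folklore] -/
theorem cstabE_zero (hρ : Continuous ρ) (H E : Finset (Plaq d)) :
    ∃ Λ₀ : Finset (Literature.Probability.LatticeModels.Site d),
      (∀ Λ, Λ₀ ⊆ Λ → JetEq 0 (ratioZ ρ Λ H E) (ratioZ ρ Λ₀ H E)) ∧
      ∀ (c : Literature.Probability.LatticeModels.Site d) (r L : ℕ),
        (∀ p ∈ H ∪ E, ∀ k, (p.1 k - c k).natAbs ≤ r) → 2 * (r + 0 + 2) ≤ L →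
          JetEq 0 (tratio ρ (L + 1) H E) (ratioZ ρ Λ₀ H E) :=
  ⟨∅, fun Λ _ => JetEq.of_bddAt (bddAt_ratioZ hρ Λ H E) (bddAt_ratioZ hρ ∅ H E),
    fun _ _ L _ _ => JetEq.of_bddAt (bddAt_tratio hρ L H E) (bddAt_ratioZ hρ ∅ H E)⟩

/-- **Single removal, inductive step of the explicit cross-stabilisation.** If all ratios
cross-stabilise to all orders `m ≤ n` with the explicit torus threshold `2 (r + m + 2) ≤ L`, the
single-removal ratios cross-stabilise to order `n + 1` with threshold `2 (r + n + 3) ≤ L`: the tree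
proof of `cstab_single`, the torus side using the explicit injectivity windows (the projection is
injective on `ballP q (n+2) ∪ H` and `torusEdge` on the bonds over `siteBall q.1 (n+2)` once
`2 (r + n + 2) < L + 1`) and the induction hypotheses for `(insert q H, nbAll X)`, `X` connected
through `q` of size `s ≤ n + 1`, whose labels lie within `r + s` of the centre. [folklore] -/
theorem cstabE_single (hρ : Continuous ρ) {n : ℕ}
    (IH : ∀ m ≤ n, ∀ H E : Finset (Plaq d),
      ∃ Λ₀ : Finset (Literature.Probability.LatticeModels.Site d),
        (∀ Λ, Λ₀ ⊆ Λ → JetEq m (ratioZ ρ Λ H E) (ratioZ ρ Λ₀ H E)) ∧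
        ∀ (c : Literature.Probability.LatticeModels.Site d) (r L : ℕ),
          (∀ p ∈ H ∪ E, ∀ k, (p.1 k - c k).natAbs ≤ r) → 2 * (r + m + 2) ≤ L →
            JetEq m (tratio ρ (L + 1) H E) (ratioZ ρ Λ₀ H E))
    (H : Finset (Plaq d)) (q : Plaq d) :
    ∃ Λ₀ : Finset (Literature.Probability.LatticeModels.Site d),
      (∀ Λ, Λ₀ ⊆ Λ → JetEq (n + 1) (ratioZ ρ Λ H {q}) (ratioZ ρ Λ₀ H {q})) ∧
      ∀ (c : Literature.Probability.LatticeModels.Site d) (r L : ℕ),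
        (∀ p ∈ H ∪ {q}, ∀ k, (p.1 k - c k).natAbs ≤ r) → 2 * (r + (n + 1) + 2) ≤ L →
          JetEq (n + 1) (tratio ρ (L + 1) H {q}) (ratioZ ρ Λ₀ H {q}) := by
  classical
  by_cases hgen : q.2.1 < q.2.2 ∧ q ∉ H
  swap
  · -- degenerate case: `q` is never removed, all ratios are `1` near `0`
    have hone : ∀ Λ : Finset (Literature.Probability.LatticeModels.Site d),
        (ratioZ ρ Λ H {q}) =ᶠ[𝓝 (0 : ℂ)] fun _ => (1 : ℂ) := by
      intro Λ
      filter_upwards [closedBall_betaOne_mem_nhds d (ρ := ρ)] with β hβ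
      rw [Metric.mem_closedBall, dist_zero_right] at hβ
      have hq : q ∉ plaquettesIn Λ \ H := by
        rw [Finset.mem_sdiff, Plaq.mem_plaquettesIn]
        tauto
      have e : plaquettesIn Λ \ (H ∪ {q}) = plaquettesIn Λ \ H := by
        rw [sdiff_union_eq_sdiff_sdiff, Finset.sdiff_singleton_eq_erase, Finset.erase_eq_of_notMem hq]
      unfold ratioZ
      rw [e, div_self (partZ_ne_zero hρ hβ _)]
    have htone : ∀ L : ℕ, (tratio ρ (L + 1) H {q}) =ᶠ[𝓝 (0 : ℂ)] fun _ => (1 : ℂ) := by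
      intro L
      refine PlaqSystem.ratio_eventuallyEq_one_of_disjoint (torusSystem_regular_succ hρ L) ?_
      rw [Finset.image_singleton, Finset.disjoint_singleton_right, tV, Finset.mem_sdiff,
        mem_torusGenuine, torusProj_snd, not_and, not_not]
      intro hlt
      by_contra hqH
      exact hgen ⟨hlt, fun h => hqH (Finset.mem_image_of_mem _ h)⟩
    exact ⟨∅, fun Λ _ => (JetEq.of_eventuallyEq (hone Λ)).trans (JetEq.of_eventuallyEq (hone ∅)).symm,
      fun _ _ L _ _ => (JetEq.of_eventuallyEq (htone L)).trans (JetEq.of_eventuallyEq (hone ∅)).symm⟩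
  obtain ⟨hlt, hqH⟩ := hgen
  -- the stabilised family of small polymers through `q`
  set Λb : Finset (Literature.Probability.LatticeModels.Site d) := Plaq.siteBall q.1 (n + 2) with hΛb
  set SC : Finset (Finset (Plaq d)) := Plaq.smallConn q (n + 1) H Λb with hSC
  have hIH : ∀ X : Finset (Plaq d), ∃ Λ₀ : Finset (Literature.Probability.LatticeModels.Site d), X ∈ SC →
      (∀ Λ, Λ₀ ⊆ Λ → JetEq (n + 1 - X.card) (ratioZ ρ Λ (insert q H) (Plaq.nbAll X))
        (ratioZ ρ Λ₀ (insert q H) (Plaq.nbAll X))) ∧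
      ∀ (c : Literature.Probability.LatticeModels.Site d) (r L : ℕ),
        (∀ p ∈ insert q H ∪ Plaq.nbAll X, ∀ k, (p.1 k - c k).natAbs ≤ r) →
          2 * (r + (n + 1 - X.card) + 2) ≤ L →
          JetEq (n + 1 - X.card) (tratio ρ (L + 1) (insert q H) (Plaq.nbAll X))
            (ratioZ ρ Λ₀ (insert q H) (Plaq.nbAll X)) := by
    intro X
    by_cases hX : X ∈ SC
    · have hcard : 1 ≤ X.card := (Plaq.mem_smallConn.1 hX).2.1.card_pos
      obtain ⟨Λ₀, hΛ₀, hT⟩ := IH (n + 1 - X.card) (by omega) (insert q H) (Plaq.nbAll X)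
      exact ⟨Λ₀, fun _ => ⟨hΛ₀, hT⟩⟩
    · exact ⟨∅, fun h => (hX h).elim⟩
  choose Λ₀ hΛ₀ using hIH
  set Λ₁ : Finset (Literature.Probability.LatticeModels.Site d) := Λb ∪ SC.biUnion Λ₀ with hΛ₁
  -- the common jet
  set Ψ : ℂ → ℂ := fun β => 1 + ∑ X ∈ SC, zPol ρ X β * ratioZ ρ (Λ₀ X) (insert q H) (Plaq.nbAll X) β
    with hΨ
  -- the `ℤ^d` side (as in `stab_single`)
  have mainZ : ∀ Λ : Finset (Literature.Probability.LatticeModels.Site d), Λ₁ ⊆ Λ →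
      JetEq (n + 1) (fun β => (ratioZ ρ Λ H {q} β)⁻¹) Ψ := by
    intro Λ hΛ
    have hball : Plaq.siteBall q.1 (n + 2) ⊆ Λ := Finset.subset_union_left.trans hΛ
    have hqP : q ∈ plaquettesIn Λ :=
      Plaq.subset_plaquettesIn_of_isConn (Polymer.isConn_singleton (adj := Plaq.Adj) q)
        (fun p hp => by rw [Finset.mem_singleton.1 hp]; exact hlt) (k := n + 1) (by simp) hball
        (Finset.mem_singleton_self q)
    have hqV : q ∈ plaquettesIn Λ \ H := Finset.mem_sdiff.2 ⟨hqP, hqH⟩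
    have hSCΛ : Plaq.smallConn q (n + 1) H Λ = SC := Plaq.smallConn_eq_of_subset hball subset_rfl
    set CΛ := (plaquettesIn Λ \ H).powerset.filter (fun X => Polymer.IsConn Plaq.Adj X q) with hCΛ
    set LG := CΛ.filter (fun X => ¬ X.card ≤ n + 1) with hLG
    have hsmallset : CΛ.filter (fun X => X.card ≤ n + 1) = SC := by
      rw [← hSCΛ]
      ext X
      simp only [hCΛ, Finset.filter_filter, Finset.mem_filter, Finset.mem_powerset,
        Plaq.mem_smallConn]
    have hid : (fun β => (ratioZ ρ Λ H {q} β)⁻¹) =ᶠ[𝓝 (0 : ℂ)] fun β =>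
        1 + (∑ X ∈ SC, zPol ρ X β * ratioZ ρ Λ (insert q H) (Plaq.nbAll X) β +
          ∑ X ∈ LG, zPol ρ X β * ratioZ ρ Λ (insert q H) (Plaq.nbAll X) β) := by
      filter_upwards [closedBall_betaOne_mem_nhds d (ρ := ρ)] with β hβ
      rw [Metric.mem_closedBall, dist_zero_right] at hβ
      rw [inv_ratioZ_single_eq hρ hβ hqV, ← Finset.sum_filter_add_sum_filter_not CΛ
        (fun X => X.card ≤ n + 1), hsmallset]
    have hsmall : JetEq (n + 1) (fun β => ∑ X ∈ SC, zPol ρ X β * ratioZ ρ Λ (insert q H) (Plaq.nbAll X) β)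
        (fun β => ∑ X ∈ SC, zPol ρ X β * ratioZ ρ (Λ₀ X) (insert q H) (Plaq.nbAll X) β) := by
      refine JetEq.sum SC fun X hX => ?_
      have hXΛ : Λ₀ X ⊆ Λ :=
        (Finset.subset_biUnion_of_mem Λ₀ hX).trans (Finset.subset_union_right.trans hΛ)
      have h1 := (hΛ₀ X hX).1 Λ hXΛ
      have h2 := JetEq.mul_isBigO (zPol_isBigO hρ X) h1
      have hle : X.card ≤ n + 1 := (Plaq.mem_smallConn.1 hX).2.2
      rwa [Nat.add_sub_cancel' hle] at h2
    have hlarge : JetEq (n + 1) (fun β => ∑ X ∈ LG, zPol ρ X β * ratioZ ρ Λ (insert q H) (Plaq.nbAll X) β)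
        (fun _ => 0) := by
      have h := JetEq.sum LG (G := fun _ _ => (0 : ℂ)) fun X hX => by
        have hgt : n + 1 ≤ X.card := by
          have := (Finset.mem_filter.1 hX).2
          omega
        exact JetEq.of_isBigO (zPol_isBigO hρ X) (bddAt_ratioZ hρ Λ (insert q H) (Plaq.nbAll X)) hgt
      simpa using h
    have hsum := (JetEq.rfl (n := n + 1) (f := fun _ => (1 : ℂ))).add (hsmall.add hlarge)
    refine (JetEq.of_eventuallyEq hid).trans ?_
    refine hsum.trans (JetEq.of_eventuallyEq (Eventually.of_forall fun β => ?_))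
    simp [hΨ]
  -- the torus side, for every `L` beyond the explicit threshold
  have mainT : ∀ (c : Literature.Probability.LatticeModels.Site d) (r L : ℕ),
      (∀ p ∈ H ∪ {q}, ∀ k, (p.1 k - c k).natAbs ≤ r) → 2 * (r + (n + 1) + 2) ≤ L →
        JetEq (n + 1) (fun β => (tratio ρ (L + 1) H {q} β)⁻¹) Ψ := by
    intro c r L hcr hL
    have hqc : ∀ k, (q.1 k - c k).natAbs ≤ r :=
      hcr q (Finset.mem_union_right _ (Finset.mem_singleton_self q))
    have hHc : ∀ p ∈ H, ∀ k, (p.1 k - c k).natAbs ≤ r := fun p hp => hcr p (Finset.mem_union_left _ hp)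
    have hL1 : ∀ X ∈ SC, JetEq (n + 1 - X.card)
        (tratio ρ (L + 1) (insert q H) (Plaq.nbAll X)) (ratioZ ρ (Λ₀ X) (insert q H) (Plaq.nbAll X)) := by
      intro X hX
      obtain ⟨-, hc, hk⟩ := Plaq.mem_smallConn.1 hX
      refine (hΛ₀ X hX).2 c (r + X.card) L (fun p hp k => ?_) (by omega)
      rcases Finset.mem_union.1 hp with hp | hp
      · rcases Finset.mem_insert.1 hp with rfl | hp
        · exact (hqc k).trans (Nat.le_add_right _ _)
        · exact (hHc p hp k).trans (Nat.le_add_right _ _)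
      · obtain ⟨x, hx, hxp⟩ := Plaq.mem_nbAll.1 hp
        have h1 := Plaq.natAbs_le_of_isConn hc hx k
        have h2 := Plaq.natAbs_sub_le_one_of_adj hxp k
        have h3 := hqc k
        have h4 := hc.card_pos
        omega
    have hL2 : Set.InjOn (torusProj (L + 1)) ((Plaq.ballP q (n + 2) ∪ H : Finset (Plaq d)) : Set (Plaq d)) := by
      refine injOn_torusProj_of_natAbs_le (c := c) (r := r + (n + 2)) (by omega) fun p hp k => ?_
      rcases Finset.mem_union.1 (Finset.mem_coe.1 hp) with hp | hp
      · have h1 := Plaq.mem_ballP.1 hp k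
        have h2 := hqc k
        omega
      · exact (hHc p hp k).trans (Nat.le_add_right _ _)
    have hL3 : Set.InjOn (QuantumLattice.torusEdge (d := d) (L + 1))
        ((Λb ×ˢ (Finset.univ : Finset (Fin d)) : Finset (ZdEdge d)) : Set (ZdEdge d)) := by
      refine injOn_torusEdge_of_natAbs_le (c := c) (r := r + (n + 2)) (by omega) fun e he k => ?_
      have he' := (Finset.mem_product.1 (Finset.mem_coe.1 he)).1
      have h1 := Plaq.mem_siteBall.1 he' k
      have h2 := hqc k
      omega
    have hRL := torusSystem_regular_succ (d := d) (G := G) hρ L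
    have hqV : torusProj (L + 1) q ∈ tV (L + 1) H := by
      refine Finset.mem_sdiff.2 ⟨mem_torusGenuine.2 hlt, fun h => ?_⟩
      obtain ⟨h', hh', hph⟩ := Finset.mem_image.1 h
      have : h' = q := hL2 (Finset.mem_union_right _ hh')
        (Finset.mem_union_left _ (Plaq.self_mem_ballP q _)) hph
      exact hqH (this ▸ hh')
    set CT := (tV (L + 1) H).powerset.filter
      (fun X => Polymer.IsConn (torusSystem ρ (L + 1)).Adj X (torusProj (L + 1) q)) with hCT
    set LGT := CT.filter (fun X => ¬ X.card ≤ n + 1) with hLGT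
    have hsmallsetT : CT.filter (fun X => X.card ≤ n + 1) = SC.image (Finset.image (torusProj (L + 1))) := by
      ext X
      rw [Finset.mem_filter, hCT, Finset.mem_filter, Finset.mem_powerset, Finset.mem_image, and_assoc,
        torusSystem_adj_eq]
      exact mem_image_smallConn_iff hL2
    have hinjSC : Set.InjOn (Finset.image (torusProj (L + 1))) (SC : Set (Finset (Plaq d))) :=
      injOn_image_smallConn hL2
    -- activities and neighbourhoods of the projected small polymers
    have hterm : ∀ X ∈ SC, ∀ β : ℂ,
        (torusSystem ρ (L + 1)).zPol (X.image (torusProj (L + 1))) β *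
            (torusSystem ρ (L + 1)).ratio ((tV (L + 1) H).erase (torusProj (L + 1) q))
              ((torusSystem ρ (L + 1)).nbAll (X.image (torusProj (L + 1)))) β =
          zPol ρ X β * tratio ρ (L + 1) (insert q H) (Plaq.nbAll X) β := by
      intro X hX β
      obtain ⟨hXV, hc, hk⟩ := Plaq.mem_smallConn.1 hX
      have hbonds : X.biUnion Plaq.bonds ⊆ Λb ×ˢ (Finset.univ : Finset (Fin d)) := by
        intro e he
        obtain ⟨p, hp, hep⟩ := Finset.mem_biUnion.1 he
        exact Finset.mem_product.2 ⟨Plaq.fst_mem_of_mem_bonds (Finset.mem_sdiff.1 (hXV hp)).1 hep,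
          Finset.mem_univ _⟩
      rw [zPol_image_torusProj ρ hρ (hL3.mono (by exact_mod_cast hbonds)), nbAll_image_torusProj,
        tV_erase]
      rfl
    have hid : (fun β => (tratio ρ (L + 1) H {q} β)⁻¹) =ᶠ[𝓝 (0 : ℂ)] fun β =>
        1 + (∑ X ∈ SC, zPol ρ X β * tratio ρ (L + 1) (insert q H) (Plaq.nbAll X) β +
          ∑ X ∈ LGT, (torusSystem ρ (L + 1)).zPol X β *
            (torusSystem ρ (L + 1)).ratio ((tV (L + 1) H).erase (torusProj (L + 1) q))
              ((torusSystem ρ (L + 1)).nbAll X) β) := by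
      filter_upwards [PlaqSystem.closedBall_betaR_mem_nhds hRL] with β hβ
      rw [Metric.mem_closedBall, dist_zero_right] at hβ
      have h0 : tratio ρ (L + 1) H {q} β =
          (torusSystem ρ (L + 1)).ratio (tV (L + 1) H) {torusProj (L + 1) q} β := by
        simp [tratio]
      rw [h0, PlaqSystem.inv_ratio_single_eq hRL hβ hqV, ← Finset.sum_filter_add_sum_filter_not CT
        (fun X => X.card ≤ n + 1), hsmallsetT, Finset.sum_image hinjSC]
      congr 2
      exact Finset.sum_congr rfl fun X hX => hterm X hX β
    have hsmall : JetEq (n + 1)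
        (fun β => ∑ X ∈ SC, zPol ρ X β * tratio ρ (L + 1) (insert q H) (Plaq.nbAll X) β)
        (fun β => ∑ X ∈ SC, zPol ρ X β * ratioZ ρ (Λ₀ X) (insert q H) (Plaq.nbAll X) β) := by
      refine JetEq.sum SC fun X hX => ?_
      have h2 := JetEq.mul_isBigO (zPol_isBigO hρ X) (hL1 X hX)
      have hle : X.card ≤ n + 1 := (Plaq.mem_smallConn.1 hX).2.2
      rwa [Nat.add_sub_cancel' hle] at h2
    have hlarge : JetEq (n + 1)
        (fun β => ∑ X ∈ LGT, (torusSystem ρ (L + 1)).zPol X β *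
          (torusSystem ρ (L + 1)).ratio ((tV (L + 1) H).erase (torusProj (L + 1) q))
            ((torusSystem ρ (L + 1)).nbAll X) β)
        (fun _ => 0) := by
      have h := JetEq.sum LGT (G := fun _ _ => (0 : ℂ)) fun X hX => by
        have hgt : n + 1 ≤ X.card := by
          have := (Finset.mem_filter.1 hX).2
          omega
        exact JetEq.of_isBigO (PlaqSystem.zPol_isBigO hRL X) (PlaqSystem.bddAt_ratio hRL
          ((tV (L + 1) H).erase (torusProj (L + 1) q)) ((torusSystem ρ (L + 1)).nbAll X)) hgt
      simpa using h
    have hsum := (JetEq.rfl (n := n + 1) (f := fun _ => (1 : ℂ))).add (hsmall.add hlarge)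
    refine (JetEq.of_eventuallyEq hid).trans ?_
    refine hsum.trans (JetEq.of_eventuallyEq (Eventually.of_forall fun β => ?_))
    simp [hΨ]
  refine ⟨Λ₁, fun Λ hΛ => ?_, fun c r L hcr hL => ?_⟩
  · exact JetEq.of_inv ((mainZ Λ hΛ).trans (mainZ Λ₁ subset_rfl).symm) (bddAt_ratioZ hρ _ _ _)
      (bddAt_ratioZ hρ _ _ _) (eventually_ratioZ_ne_zero hρ _ _ _) (eventually_ratioZ_ne_zero hρ _ _ _)
  · exact JetEq.of_inv ((mainT c r L hcr hL).trans (mainZ Λ₁ subset_rfl).symm) (bddAt_tratio hρ _ _ _)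
      (bddAt_ratioZ hρ _ _ _) (eventually_tratio_ne_zero hρ _ _ _) (eventually_ratioZ_ne_zero hρ _ _ _)

end CrossStab

/-- **Registered sub-goal `TorusCrossStabSingle`** (support I of stub `TorusFiniteSizeRate`): the
single-removal inductive step of the explicit cross-stabilisation, `cstabE_single`. [folklore] -/
theorem TorusCrossStabSingle : open Literature.MathematicalPhysics.QuantumFieldTheory in ∀ {d N : ℕ} {G : Type*} [Group G] [TopologicalSpace G] [IsTopologicalGroup G] [CompactSpace G] [MeasurableSpace G] [BorelSpace G] {ρ : G →* Matrix (Fin N) (Fin N) ℂ}, Continuous ρ → ∀ {n : ℕ}, (∀ m ≤ n, ∀ H E : Finset (Plaq d), ∃ Λ₀ : Finset (Literature.Probability.LatticeModels.Site d), (∀ Λ, Λ₀ ⊆ Λ → JetEq m (ratioZ ρ Λ H E) (ratioZ ρ Λ₀ H E)) ∧ ∀ (c : Literature.Probability.LatticeModels.Site d) (r L : ℕ), (∀ p ∈ H ∪ E, ∀ k, (p.1 k - c k).natAbs ≤ r) → 2 * (r + m + 2) ≤ L → JetEq m (tratio ρ (L + 1) H E) (ratioZ ρ Λ₀ H E)) →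 ∀ (H : Finset (Plaq d)) (q : Plaq d), ∃ Λ₀ : Finset (Literature.Probability.LatticeModels.Site d), (∀ Λ, Λ₀ ⊆ Λ → JetEq (n + 1) (ratioZ ρ Λ H {q}) (ratioZ ρ Λ₀ H {q})) ∧ ∀ (c : Literature.Probability.LatticeModels.Site d) (r L : ℕ), (∀ p ∈ H ∪ {q}, ∀ k, (p.1 k - c k).natAbs ≤ r) → 2 * (r + (n + 1) + 2) ≤ L → JetEq (n + 1) (tratio ρ (L + 1) H {q}) (ratioZ ρ Λ₀ H {q}) :=
  fun hρ _ IH H q => cstabE_single hρ IH H q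

end Summit.QuantumFields.YangMills.Theorems.CurvatureKernel

end
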